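import Summits.AnomalousDissipation.AnomalousDissipation.Theses.VirtualDissipation
import Summits.AnomalousDissipation.AnomalousDissipation.Theorems.LightSteadyStatesGP.Negative.TrivialWitnesses
import Literature.Analysis.FunctionSpaces.TorusFluidGlueProofs

/-!
# Disproof of `LightSteadyStatesGP` — findings of the standing adversary
# (crux stmt-AnomalousDissipation-15151, route `VirtualDissipation`, rank 3; cdisprove cycle 1, 2026-08-17)

CRUX (by name `…Theses.VirtualDissipation.LightSteadyStatesGP`): `∃ ν_j ∈ (0,1]`, `ν_j → 0`, classical steady
states `(u_j,p_j)` of `NS_{ν_j}(f_GP)` on the unit torus (`Torus.IsClassicalNSSolutionOn univ` on constant data;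
`f_GP(x) = sin(2πx₂)e₀ + sin(2πx₀)e₁ + sin(2πx₁)e₂` inline) with `∫u_j = 0`, `∫|u_j|² ≤ 2`.

VERDICT SO FAR: **NOT refuted — the crux resists** (open-problem grade; see "Why it resists").  A disproof is
exactly `HeavyBelow` (§4: below some `ν₀`, EVERY mean-zero classical steady state of `f_GP` has energy `> 2`),
for which no method exists; numerics run the other way (primary odd-cyclic branch LIGHT ∧ LOUD down to
`ν_box = 0.0144`, `E_unit = 1.02 ≤ 2`, `ε_unit ≈ 0.36`; item evidence NumericsJ018975.md).
Everything below is `sorry`-free with standard axioms unless marked NEAR-MISS; prose lives in docstrings.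

## Index of findings (this cycle)

LANDED / PROPOSED under `Theorems/LightSteadyStatesGP/Negative/` (import them from there, not from here):
* `Negative/TrivialWitnesses.lean` (p150383, crux-attack c1): `zero_not_steadyStateGP`, `laminar_not_steadyStateGP`
  — neither `u = 0` nor `c • f_GP` is a steady state: no explicit one-mode witness and no one-mode obstruction.
* `Negative/LevelFloor.lean` (p162094, this seat): `reproduction_identity` `3/2 = 4π²ν∫⟪f_GP,u⟫ − ∫⟪Df_GP u,u⟫`;
  `floor` `3/2 ≤ (2π + 2π²ν)∫|u|² + 3π²ν` at EVERY classical steady state (any mean); the census signature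
  `stub_energyFloorGP` discharged (`energyFloorGP_census`); `dissipation_sq_le_of_light` `(ν‖∇u‖²)² ≤ 3` for
  light states; **`not_lightSteadyStatesGP_atLevel_of_lt`**: the crux-shape with level `E < 3/(4π) ≈ 0.2387`
  in place of `2` is FALSE (natural strengthening refuted; the level is load-bearing only below `3/(4π)`);
  `lightSteadyStatesGP_witness_shell` (every witness slice: `3/(4π) − O(ν_j) ≤ ∫|u_j|² ≤ 2`, `ε_j ≤ √3`).
* `Negative/AprioriRegime.lean` (p162282, this seat): `ceiling` `∫|u|² ≤ 3/(32π⁴ν²)`, `ν‖∇u‖² ≤ 3/(8π²ν)` for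
  MEAN-ZERO classical steady states; `exists_light_meanZero_steadyStateGP_of_le` — light mean-zero classical
  steady states EXIST for every `ν ≥ √3/(8π²) ≈ 0.02194` (`ν_box ≥ 0.3455`); **`lightSteadyStatesGP_withoutVanishing`**
  — the crux with `ν_j → 0` DROPPED is TRUE; `lightSteadyStatesGP_iff_withoutLeOne` — `ν_j ≤ 1` is redundant.

IN THIS FILE (work file of the crux; cite, do not import):
* §0 vocabulary (`fGP` = the inline force, `IsSteadyGP`, `Crux`), `crux_iff` (`Iff.rfl`).
* §1 LOAD-BEARING ANALYSIS, clause by clause (theorems here or pointers to the Negative files):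
  - `ν_j → 0`: dropped ⇒ TRUE (`lightSteadyStatesGP_withoutVanishing`, p162282).  THE load-bearing clause.
  - `ν_j ≤ 1`: redundant (`lightSteadyStatesGP_iff_withoutLeOne`, p162282).
  - `0 < ν_j`: sign-symmetric — `(u,p)` solves `NS_ν(f_GP)` iff `(−u,p)` solves `NS_{−ν}(f_GP)` (sibling work
    file `Cruxes/SteadyStatesLoudBounded/Disproof.lean`, `isSteady_neg_neg`); admitting `ν_j < 0` adds mirror
    images only; admitting `ν_j = 0` would admit exact smooth mean-zero Euler dodgers of `f_GP` in the 2-ball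
    (none known; excluded by the sibling crux `LambRigidGP`).
  - `HasZeroMean u_j`: NOT used by the floor; used by the a-priori ceiling (Poincaré) only; its role is to exclude
    drift/KAM states (`u = c + v`, the objects that refuted every any-mean statement in the negatives index,
    items 2979/2984) — for an ∃-crux dropping it only WEAKENS the statement; no Lean-grade witness either way.
  - level `2`: any level `< 3/(4π)` is refuted (p162094); every level in `[3/(4π), ∞)` is open.
  - `classical`: not load-bearing (steady weak `H¹` solutions are smooth in 3-D, `Temam1979_steadyWeakSolution_smooth_holds`).
* §2 TIGHTNESS: the only two a-priori identities (energy, reproduction) give the shell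
  `3/(4π) − O(ν) ≤ ∫|u|² ≤ 3/(32π⁴ν²)` and `ε ≤ √3` on light states; both bounds are attained in ORDER by known
  objects of OTHER forces only (fat laminar branches `E ∼ ν⁻²`; no small steady states) — for `f_GP` the laminar
  ansatz is not a solution (p150383), so neither bound is known to be sharp for `f_GP`.
* §3 STRENGTHENINGS: level `< 3/(4π)` refuted (p162094).  The ∀-strengthening "symmetric CEILING along a sequence"
  (`SymmCeilingSeq` of the census) and "light at EVERY ν" (`SymmLightAllNu`) are not refutable here: the fat
  Beltrami half-branches `h±/(4π²ν)` are NOT exact steady states of `f_GP = h₊ + h₋` (only of `h±` alone), so no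
  explicit heavy mean-zero state of `f_GP` is available in Lean at any `ν`.
* §4 THE SHAPE OF A DISPROOF, in the route's own currency (NEW, proved here):
  `HeavyBelow ↔ ¬Crux` (re-proved from the census sketch) and **`not_crux_of_strongLambRigidGP`**: if `f_GP` is
  Lamb-rigid in the 2-ball with a constant `c > √3` (the sibling crux `LambRigidGP`'s inequality at level `2`,
  with `√3 < c` in place of `0 < c`), the crux is FALSE; equivalently (`rigidityConstant_le_of_crux`) **if the crux
  holds, every Lamb-rigidity constant of `f_GP` at any level `E ≥ 2` is `≤ √3`**.  So the route lives in the
  band `min(c, δ₀²) ≤ ε_j ≤ √3` and a disproof must push a VISCOSITY-FREE rigidity constant past `√3` — a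
  super-Onsager statement contradicted in trend by the bounded plateau `ε ≈ 0.36` of the light numerical branch.
* §5 NEAR-MISSES / not attempted in Lean: `HeavyBelow` itself (no method); exact drift (windy) steady states of
  `f_GP` (exist numerically at `|d| = 3`, `E ≈ 9`, heavy — irrelevant to ∃); the 2-D negative transfer (Marchioro)
  fails since `(f_GP·∇)f_GP` is not a gradient (`laminar_not_steadyStateGP`).
* `-- Targets`: none this cycle (payload `stuck_stubs = []`, no line attached).  LINE NOTE (birth): its wall
  instance `Φ = E − 2` dies iff the primary symmetric continuum from `ν = 1` reaches `E_unit > 2` (IVT); by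
  `rigidityConstant_le_of_crux` a LOUD light continuum also caps the sibling constant at `√3`.

## Why it resists (briefing)
* `¬Crux ↔ HeavyBelow`: a statement about where ALL mean-zero steady branches of ONE force sit relative to ONE
  level as `ν → 0`.  The only coercive a-priori handle points the wrong way (FLOOR `0.2387`, not a ceiling); the
  ceiling `3/(32π⁴ν²)` is vacuous as `ν → 0`; light FAKES exist in every weak norm (stationary `L^∞` h-principle,
  explicit subsolution `div τ̄ = f_GP` with generalised energy `≤ 3/(2π)`), so heaviness can only come from the
  exact viscous structure = `StrongLambRigidGP`/`SuperRigidGP`, the negation of frozen turbulence for `f_GP`.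
* Numerics cannot refute an ∃-crux (heavy on one branch never refutes); trend data support it to `ν_box = 0.0144`.
* Literature: bounded sequences of stationary forced periodic NS solutions are "an open problem" already in 2-D
  (Constantin–Tarfulea–Vicol, arXiv:1305.7089, p. 3); in 3-D nothing beyond Leray–Schauder existence is known.
-/

set_option linter.dupNamespace false

noncomputable section

open MeasureTheory Set Filter Topology
open scoped InnerProductSpace RealInnerProductSpace

namespace Summit.AnomalousDissipation.AnomalousDissipation.Cruxes.LightSteadyStatesGP.Disproof

open Literature.Analysis.FunctionSpaces Literature.Analysis.FunctionSpaces.Torus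
open Literature.Analysis.FluidPDE Literature.Analysis.FluidPDE.Torus
open Summit.AnomalousDissipation.AnomalousDissipation.Theorems.EnsembleRigidity
open Summit.AnomalousDissipation.AnomalousDissipation.Theorems.EnsembleRigidity.GPStatisticalRigidity
open Summit.AnomalousDissipation.AnomalousDissipation.Theorems.EnsembleRigidity.GPMeanBoundedFamily
open Summit.AnomalousDissipation.AnomalousDissipation.Theorems.LightSteadyStatesGP.Negative

/-! ## §0 Vocabulary -/

/-- The pinned force, verbatim the inline expression of the crux; it IS `EnsembleRigidity.gpForce` (`rfl`). [folklore] -/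
abbrev fGP : UnitAddTorus (Fin 3) → EuclideanSpace ℝ (Fin 3) := fun x =>
  (stokesMode (Pi.single (2 : Fin 3) (1 : ℤ)) (EuclideanSpace.single (0 : Fin 3) (1 : ℝ)) false x +
    stokesMode (Pi.single (0 : Fin 3) (1 : ℤ)) (EuclideanSpace.single (1 : Fin 3) (1 : ℝ)) false x +
    stokesMode (Pi.single (1 : Fin 3) (1 : ℤ)) (EuclideanSpace.single (2 : Fin 3) (1 : ℝ)) false x :
    EuclideanSpace ℝ (Fin 3))

theorem fGP_eq_gpForce : fGP = gpForce := rfl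

/-- `(u,p)` is a classical steady state of `NS_ν(f_GP)` — the crux's clause. [folklore] -/
abbrev IsSteadyGP (ν : ℝ) (u : UnitAddTorus (Fin 3) → EuclideanSpace ℝ (Fin 3))
    (p : UnitAddTorus (Fin 3) → ℝ) : Prop :=
  IsClassicalNSSolutionOn Set.univ ν (fun _ => fGP) (fun _ => u) (fun _ => p)

/-- The crux, by name. -/
abbrev Crux : Prop :=
  Summit.AnomalousDissipation.AnomalousDissipation.Theses.VirtualDissipation.LightSteadyStatesGP

/-- Readback: the decl is literally the level-`2` light-steady-state shape (`Iff.rfl`). [folklore] -/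
theorem crux_iff :
    Crux ↔ ∃ (ν : ℕ → ℝ) (u : ℕ → UnitAddTorus (Fin 3) → EuclideanSpace ℝ (Fin 3))
      (p : ℕ → UnitAddTorus (Fin 3) → ℝ), (∀ j, 0 < ν j ∧ ν j ≤ 1) ∧ Tendsto ν atTop (𝓝 0) ∧
        (∀ j, IsSteadyGP (ν j) (u j) (p j)) ∧ (∀ j, HasZeroMean (u j)) ∧ ∀ j, ∫ x, ‖u j x‖ ^ 2 ≤ 2 :=
  Iff.rfl

/-! ## §1 Load-bearing clauses (prose index; the theorems live in the Negative files listed above)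

* `ν_j → 0` dropped ⇒ TRUE (`Negative.AprioriRegime.lightSteadyStatesGP_withoutVanishing`).
* `ν_j ≤ 1` ⇔ redundant (`Negative.AprioriRegime.lightSteadyStatesGP_iff_withoutLeOne`).
* `0 < ν_j`: a mirror — `(u,p)` solves `NS_ν(f)` iff `(−u,p)` solves `NS_{−ν}(f)` (`(−ν)Δ(−u) = νΔu`,
  `((−u)·∇)(−u) = (u·∇)u`; proved for the weak form as `isSteady_neg_neg` in the sibling work file
  `Cruxes/SteadyStatesLoudBounded/Disproof.lean` §2); only `ν_j = 0` (exact smooth Euler dodgers of `f_GP` in the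
  2-ball, excluded by the sibling crux `LambRigidGP`) would be new.
* `HasZeroMean u_j`: unused by the floor, used by the ceiling (Poincaré); excludes drift states; dropping it only
  weakens an ∃-statement.
* level `2`: `< 3/(4π)` refuted (`Negative.LevelFloor.not_lightSteadyStatesGP_atLevel_of_lt`); `[3/(4π), ∞)` open.
-/

/-! ## §2 A-priori identities used below (private copies of `Negative/LevelFloor.lean`, p162094 pending) -/

/-- `ν‖∇u‖² = ∫⟪f_GP,u⟫` (copy of `Negative.LevelFloor.energy_identity`). [folklore] -/
theorem energy_identity {ν : ℝ} {u : UnitAddTorus (Fin 3) → EuclideanSpace ℝ (Fin 3)}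
    {p : UnitAddTorus (Fin 3) → ℝ} (h : IsSteadyGP ν u p) : ν * gradNormSq u = ∫ x, ⟪gpForce x, u x⟫_ℝ := by
  have hd := IsClassicalNSSolutionOn.energy_balance_holds h convex_univ (Set.mem_univ (0 : ℝ))
  rw [hasDerivWithinAt_univ] at hd
  have h0 : HasDerivAt (fun _ : ℝ => kineticEnergy u) (0 : ℝ) (0 : ℝ) := hasDerivAt_const _ _
  have := h0.unique hd
  change (0 : ℝ) = -ν * gradNormSq u + ∫ x, ⟪gpForce x, u x⟫_ℝ at this
  linarith

/-- `(∫⟪f_GP,u⟫)² ≤ (3/2)∫|u|²` (copy of `Negative.LevelFloor.work_sq_le`). [folklore] -/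
theorem work_sq_le {u : UnitAddTorus (Fin 3) → EuclideanSpace ℝ (Fin 3)} (hu : IsSmooth u) :
    (∫ x, ⟪gpForce x, u x⟫_ℝ) ^ 2 ≤ 3 / 2 * ∫ x, ‖u x‖ ^ 2 := by
  have hfs : IsSmooth gpForce := gpForce_isSmooth
  have key : ∀ t : ℝ, 2 * t * ∫ x, ⟪gpForce x, u x⟫_ℝ ≤ t ^ 2 * (3 / 2) + ∫ x, ‖u x‖ ^ 2 := by
    intro t
    have hpt : ∀ x, 2 * t * ⟪gpForce x, u x⟫_ℝ ≤ t ^ 2 * ‖gpForce x‖ ^ 2 + ‖u x‖ ^ 2 := by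
      intro x
      have h0 : 0 ≤ ‖t • gpForce x - u x‖ ^ 2 := sq_nonneg _
      rw [norm_sub_sq_real, real_inner_smul_left, norm_smul, mul_pow, Real.norm_eq_abs, sq_abs] at h0
      linarith
    have i1 : Integrable (fun x => 2 * t * ⟪gpForce x, u x⟫_ℝ) volume := (hfs.inner hu).integrable.const_mul _
    have i2 : Integrable (fun x => t ^ 2 * ‖gpForce x‖ ^ 2 + ‖u x‖ ^ 2) volume :=
      (hfs.norm_sq.integrable.const_mul _).add hu.norm_sq.integrable
    have h := integral_mono i1 i2 hpt
    rw [integral_const_mul, integral_add (hfs.norm_sq.integrable.const_mul _) hu.norm_sq.integrable,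
      integral_const_mul, StubHeadCoefficients.integral_norm_sq_gpForce] at h
    exact h
  set W := ∫ x, ⟪gpForce x, u x⟫_ℝ with hW
  have h := key (2 * W / 3)
  nlinarith [h]

/-- A light steady state dissipates `< 2` (indeed `≤ √3`): `(ν‖∇u‖²)² ≤ 3`. [folklore] -/
theorem dissipation_sq_le_of_light {ν : ℝ} {u : UnitAddTorus (Fin 3) → EuclideanSpace ℝ (Fin 3)}
    {p : UnitAddTorus (Fin 3) → ℝ} (h : IsSteadyGP ν u p) (hE : ∫ x, ‖u x‖ ^ 2 ≤ 2) :
    (ν * gradNormSq u) ^ 2 ≤ 3 := by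
  rw [energy_identity h]
  have h1 := work_sq_le (h.smooth_velocity.isSmooth_slice (Set.mem_univ (0 : ℝ)))
  nlinarith [h1, hE]

/-! ## §3 Residual transfer: at a steady state the Euler residual IS the viscous pairing -/

/-- **Residual transfer** (as inside the route's `closes`): at a classical steady state of `NS_ν(f_GP)`,
`ν > 0`, `R = ν‖∇u‖₂` is an admissible dual-enstrophy residual bound:
`|∫⟪(u·∇)u − f_GP, w⟫| ≤ (ν‖∇u‖₂)‖∇w‖₂` for every smooth divergence-free mean-zero `w`. [folklore] -/
theorem residual_le {ν : ℝ} (hν : 0 < ν) {u : UnitAddTorus (Fin 3) → EuclideanSpace ℝ (Fin 3)}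
    {p : UnitAddTorus (Fin 3) → ℝ} (h : IsSteadyGP ν u p) :
    ∀ w : UnitAddTorus (Fin 3) → EuclideanSpace ℝ (Fin 3), IsSmooth w → IsDivFree w → HasZeroMean w →
      |∫ x, ⟪convect u u x - gpForce x, w x⟫_ℝ| ≤
        (ν * Real.sqrt (gradNormSq u)) * Real.sqrt (gradNormSq w) := by
  -- pattern from the route's `closes` (Theses/VirtualDissipation.lean, `hres`)
  intro w hw hwd hwz
  have hu : IsSmooth u := h.smooth_velocity.isSmooth_slice (Set.mem_univ (0 : ℝ))
  have hp : IsSmooth p := h.smooth_pressure.isSmooth_slice (Set.mem_univ (0 : ℝ))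
  have hfs : IsSmooth gpForce := gpForce_isSmooth
  have hpt : ∀ x, ν • laplacian u x - convect u u x + gpForce x = Torus.gradient p x := by
    intro x
    have hm := h.momentum 0 (Set.mem_univ _) x
    have h0 : Torus.timeDerivWithin Set.univ (fun _ : ℝ => u) 0 x = 0 := by simp [Torus.timeDerivWithin]
    rw [h0, zero_add] at hm
    have hm' : convect u u x = ν • laplacian u x - Torus.gradient p x + gpForce x := hm
    rw [hm']
    abel
  have h0 : ∫ x, ⟪ν • laplacian u x - convect u u x + gpForce x, w x⟫_ℝ = 0 := by
    simp_rw [hpt]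
    exact integral_inner_gradient_eq_zero_of_isDivFree hw hp hwd
  have iL : Integrable (fun x => ⟪ν • laplacian u x, w x⟫_ℝ) volume := ((hu.laplacian.smul ν).inner hw).integrable
  have iC : Integrable (fun x => ⟪convect u u x, w x⟫_ℝ) volume := ((hu.convect hu).inner hw).integrable
  have iF : Integrable (fun x => ⟪gpForce x, w x⟫_ℝ) volume := (hfs.inner hw).integrable
  have iLC : Integrable (fun x => ⟪ν • laplacian u x, w x⟫_ℝ - ⟪convect u u x, w x⟫_ℝ) volume := iL.sub iC
  simp_rw [inner_add_left, inner_sub_left] at h0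
  rw [integral_add iLC iF, integral_sub iL iC] at h0
  have hlap : ∫ x, ⟪ν • laplacian u x, w x⟫_ℝ = ν * ∫ x, ⟪w x, laplacian u x⟫_ℝ := by
    simp_rw [real_inner_smul_left]
    rw [integral_const_mul]
    exact congrArg _ (integral_congr_ae (ae_of_all _ fun x => real_inner_comm _ _))
  have heq : ∫ x, ⟪convect u u x - gpForce x, w x⟫_ℝ = ν * ∫ x, ⟪w x, laplacian u x⟫_ℝ := by
    simp_rw [inner_sub_left]
    rw [integral_sub iC iF]
    linarith
  rw [heq, abs_mul, abs_of_nonneg hν.le, mul_assoc]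
  refine mul_le_mul_of_nonneg_left ?_ hν.le
  rw [mul_comm]
  exact Summit.AnomalousDissipation.AnomalousDissipation.Theorems.PhantomFloor.abs_integral_inner_laplacian_le hw hu

/-! ## §4 The shape of a disproof -/

/-- **What a disproof must deliver** (`¬Crux` unfolded): below some `ν₀ > 0` EVERY mean-zero classical steady
state of `NS_ν(f_GP)` is heavy.  (Typed in the census sketch; re-proved here.) [folklore] -/
def HeavyBelow : Prop :=
  ∃ ν₀ : ℝ, 0 < ν₀ ∧ ∀ ν : ℝ, 0 < ν → ν < ν₀ →
    ∀ (u : UnitAddTorus (Fin 3) → EuclideanSpace ℝ (Fin 3)) (p : UnitAddTorus (Fin 3) → ℝ),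
      IsSteadyGP ν u p → HasZeroMean u → 2 < ∫ x, ‖u x‖ ^ 2

theorem not_crux_of_heavyBelow : HeavyBelow → ¬ Crux := by
  rintro ⟨ν₀, hν₀, hheavy⟩ ⟨ν, u, p, hν, hν0, hsol, hmean, hE⟩
  obtain ⟨j, hj⟩ := ((tendsto_order.1 hν0).2 ν₀ hν₀).exists
  exact absurd (hE j) (not_le.2 (hheavy (ν j) (hν j).1 hj (u j) (p j) (hsol j) (hmean j)))

theorem heavyBelow_of_not_crux : ¬ Crux → HeavyBelow := by
  intro h
  by_contra hH
  apply h
  simp only [HeavyBelow, not_exists, not_and, not_forall, not_lt, exists_prop] at hH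
  choose ν hνpos hνlt u p hsol hmean hE using fun j : ℕ => hH (1 / ((j : ℝ) + 1)) Nat.one_div_pos_of_nat
  have hle : ∀ j : ℕ, 1 / ((j : ℝ) + 1) ≤ 1 := fun j => by
    rw [div_le_one (Nat.cast_add_one_pos j)]
    linarith [(Nat.cast_nonneg j : (0 : ℝ) ≤ j)]
  refine ⟨ν, u, p, fun j => ⟨hνpos j, (hνlt j).le.trans (hle j)⟩, ?_, hsol, hmean, hE⟩
  exact squeeze_zero (fun j => (hνpos j).le) (fun j => (hνlt j).le) tendsto_one_div_add_atTop_nhds_zero_nat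

theorem not_crux_iff_heavyBelow : ¬ Crux ↔ HeavyBelow := ⟨heavyBelow_of_not_crux, not_crux_of_heavyBelow⟩

/-- **Strong Lamb rigidity of `f_GP` in the 2-ball**: the sibling crux `LambRigidGP`'s inequality at level `E = 2`
with a rigidity constant ABOVE `√3` (the maximal dissipation of a light steady state) — `√3 < c` in place of
`0 < c`, everything else verbatim. [folklore] -/
def StrongLambRigidGP : Prop :=
  ∃ c δ₀ : ℝ, Real.sqrt 3 < c ∧ 0 < δ₀ ∧ ∀ u : UnitAddTorus (Fin 3) → EuclideanSpace ℝ (Fin 3), IsSmooth u →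
    IsDivFree u → HasZeroMean u → ∫ x, ‖u x‖ ^ 2 ≤ 2 → ∀ R : ℝ, 0 ≤ R →
      (∀ w : UnitAddTorus (Fin 3) → EuclideanSpace ℝ (Fin 3), IsSmooth w → IsDivFree w → HasZeroMean w →
        |∫ x, ⟪convect u u x - gpForce x, w x⟫_ℝ| ≤ R * Real.sqrt (gradNormSq w)) →
      R ≤ δ₀ → c ≤ R * Real.sqrt (gradNormSq u)

/-- **The rigidity constant is capped by the crux**: if the crux holds, then for EVERY level `E ≥ 2` and all
`c, δ₀ > 0` for which the Lamb-rigidity inequality of `f_GP` holds (the body of `LambRigidGP`), `c ≤ √3`.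
Proof: a witness slice `u_j` with `ν_j < δ₀²/2` has residual bound `R_j = ν_j‖∇u_j‖` (`residual_le`) with
`R_j² = ν_j ε_j < 2ν_j ≤ δ₀²`, so rigidity gives `c ≤ R_j‖∇u_j‖ = ε_j ≤ √3`. [folklore] -/
theorem rigidityConstant_le_of_crux (hC : Crux) {E c δ₀ : ℝ} (hE : 2 ≤ E) (hδ₀ : 0 < δ₀)
    (hrig : ∀ u : UnitAddTorus (Fin 3) → EuclideanSpace ℝ (Fin 3), IsSmooth u → IsDivFree u → HasZeroMean u →
      ∫ x, ‖u x‖ ^ 2 ≤ E → ∀ R : ℝ, 0 ≤ R →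
        (∀ w : UnitAddTorus (Fin 3) → EuclideanSpace ℝ (Fin 3), IsSmooth w → IsDivFree w → HasZeroMean w →
          |∫ x, ⟪convect u u x - gpForce x, w x⟫_ℝ| ≤ R * Real.sqrt (gradNormSq w)) →
        R ≤ δ₀ → c ≤ R * Real.sqrt (gradNormSq u)) :
    c ≤ Real.sqrt 3 := by
  obtain ⟨ν, u, p, hν, hν0, hsol, hmean, hlight⟩ := hC
  obtain ⟨j, hj⟩ := ((tendsto_order.1 hν0).2 (δ₀ ^ 2 / 2) (by positivity)).exists
  have hνj : 0 < ν j := (hν j).1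
  have hus : IsSmooth (u j) := (hsol j).smooth_velocity.isSmooth_slice (Set.mem_univ (0 : ℝ))
  have hud : IsDivFree (u j) := (hsol j).divFree 0 (Set.mem_univ _)
  set G := gradNormSq (u j) with hGdef
  have hG : 0 ≤ G := gradNormSq_nonneg _
  set R := ν j * Real.sqrt G with hRdef
  have hR0 : 0 ≤ R := mul_nonneg hνj.le (Real.sqrt_nonneg _)
  have hRG : R * Real.sqrt G = ν j * G := by rw [hRdef, mul_assoc, Real.mul_self_sqrt hG]
  have hεsq : (ν j * G) ^ 2 ≤ 3 := dissipation_sq_le_of_light (hsol j) (hlight j)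
  have hε0 : 0 ≤ ν j * G := mul_nonneg hνj.le hG
  have hε2 : ν j * G < 2 := by nlinarith
  have hR2 : R ^ 2 = ν j * (ν j * G) := by rw [hRdef, mul_pow, Real.sq_sqrt hG]; ring
  have hRδ : R ≤ δ₀ := by
    have h1 : R ^ 2 < δ₀ ^ 2 := by
      rw [hR2]
      have : ν j * (ν j * G) ≤ ν j * 2 := mul_le_mul_of_nonneg_left hε2.le hνj.le
      nlinarith
    exact le_of_lt (lt_of_pow_lt_pow_left₀ 2 hδ₀.le h1)
  have key := hrig (u j) hus hud (hmean j) ((hlight j).trans hE) R hR0 (residual_le hνj (hsol j)) hRδ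
  rw [hRG] at key
  have hεle : ν j * G ≤ Real.sqrt 3 := by
    rw [← Real.sqrt_sq hε0]
    exact Real.sqrt_le_sqrt hεsq
  exact key.trans hεle

/-- **Strong Lamb rigidity refutes the crux** (contrapositive form): `StrongLambRigidGP → ¬Crux`.  This is the
EXACT analytic content of a disproof in the route's own currency: push a viscosity-free rigidity constant of
`f_GP` in the 2-ball past `√3`.  The sibling crux `LambRigidGP` asserts only SOME `c > 0` (loudness); the light
numerical branch has `ε ≈ 0.36 ≪ √3`, i.e. trend evidence that the true constant (if any) is `≤ 0.36`. [folklore] -/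
theorem not_crux_of_strongLambRigidGP : StrongLambRigidGP → ¬ Crux := by
  rintro ⟨c, δ₀, hc, hδ₀, hrig⟩ hC
  have h := rigidityConstant_le_of_crux hC le_rfl hδ₀ hrig
  linarith

/-- Hence `StrongLambRigidGP → HeavyBelow`. [folklore] -/
theorem heavyBelow_of_strongLambRigidGP (h : StrongLambRigidGP) : HeavyBelow :=
  heavyBelow_of_not_crux (not_crux_of_strongLambRigidGP h)

/-! ## §5 Near-misses (none sorried this cycle)

Nothing here is left as `sorry`: the two statements a disproof would need — `HeavyBelow`, or its sufficient
condition `StrongLambRigidGP` — are recorded as DEFINITIONS with the reductions proved, not as claims. -/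

end Summit.AnomalousDissipation.AnomalousDissipation.Cruxes.LightSteadyStatesGP.Disproof

end
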